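import Literature.Computability.Complexity.ExtMonotoneGates
import Mathlib

/-!
# Stub `stub_convLowDimStructure` of line `width-threshold-certificate-sparsity`
(crux `CliqueExtLowerBound`, stmt-PneNP-10682)

LOW-DIMENSIONAL CONV GATES ARE ANDS OF THRESHOLDS: a CONV gate of width `≤ s` whose psd variable
has dimension `q ≤ 1` accepts `v` iff at most `(s+1)²` non-negatively weighted real threshold
conditions `h_l ≤ ∑ⱼ β_{lj} [vⱼ]` (`β ≥ 0`) all hold.

Proof. Write `rᵢ(v) := bᵢ + ∑ⱼ Bᵢⱼ [vⱼ]` (`B ≥ 0`).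
* `q = 0`: the matrix variable is the empty matrix, every trace vanishes, and the gate accepts
  iff every row `0 ≤ rᵢ(v)` holds: `p ≤ s` thresholds (`sdp_dim_zero_iff`).
* `q = 1`: `Y = (y)` is psd iff `y ≥ 0`, and `tr (Aᵢ Y) = aᵢ y` with `aᵢ := Aᵢ 0 0`
  (`sdp_dim_one_iff`). Fourier–Motzkin elimination of the single variable `y`
  (`fourierMotzkin_one`): feasible iff `0 ≤ rᵢ(v)` for every row with `aᵢ ≥ 0` and
  `0 ≤ aᵢ' rᵢ(v) + (-aᵢ) rᵢ'(v)` for every pair `aᵢ < 0 < aᵢ'`. These are `p + p²`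
  threshold conditions with non-negative weights (`fmConditions_thresholds`: rows indexed by
  `Fin p`, pairs by `Fin p × Fin p`, inactive indices carrying the vacuous condition `0 ≤ 0`),
  and `p + p² ≤ (s+1)²`.
-/

set_option linter.dupNamespace false

open Literature.Computability.Complexity Finset Matrix

noncomputable section

namespace Summit.PneNP.PneNP.Theorems.CliqueExtLowerBound.WidthThreshold.ConvLowDim

/-! ### Fourier–Motzkin elimination of one non-negative variable -/

/-- **Fourier–Motzkin in one variable.** The system `y ≥ 0, aᵢ y ≤ rᵢ (i < p)` is feasible iff
`0 ≤ rᵢ` whenever `aᵢ ≥ 0`, and `0 ≤ aᵢ' rᵢ + (-aᵢ) rᵢ'` whenever `aᵢ < 0 < aᵢ'` (the witness is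
`y = max (0, maxᵢ {rᵢ / aᵢ : aᵢ < 0})`). [folklore] -/
theorem fourierMotzkin_one {p : ℕ} (a r : Fin p → ℝ) :
    (∃ y : ℝ, 0 ≤ y ∧ ∀ i, a i * y ≤ r i) ↔
      (∀ i, 0 ≤ a i → 0 ≤ r i) ∧
        ∀ i i', a i < 0 → 0 < a i' → 0 ≤ a i' * r i + (-a i) * r i' := by
  constructor
  · rintro ⟨y, hy, hr⟩
    refine ⟨fun i hi => (mul_nonneg hi hy).trans (hr i), fun i i' hi hi' => ?_⟩
    have h1 : a i' * (a i * y) ≤ a i' * r i := mul_le_mul_of_nonneg_left (hr i) hi'.le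
    have h2 : (-a i) * (a i' * y) ≤ (-a i) * r i' :=
      mul_le_mul_of_nonneg_left (hr i') (neg_nonneg.2 hi.le)
    nlinarith [h1, h2]
  · rintro ⟨hpos, hpair⟩
    by_cases hS : (univ.filter fun i => a i < 0).Nonempty
    · obtain ⟨i₀, hi₀, hmax⟩ := exists_max_image _ (fun i => r i / a i) hS
      have ha₀ : a i₀ < 0 := (mem_filter.1 hi₀).2
      refine ⟨max 0 (r i₀ / a i₀), le_max_left _ _, fun i => ?_⟩
      rcases lt_trichotomy (a i) 0 with hi | hi | hi
      · -- a negative row: `y ≥ rᵢ / aᵢ`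
        have hle : r i / a i ≤ max 0 (r i₀ / a i₀) :=
          (hmax i (mem_filter.2 ⟨mem_univ _, hi⟩)).trans (le_max_right _ _)
        calc a i * max 0 (r i₀ / a i₀) ≤ a i * (r i / a i) := mul_le_mul_of_nonpos_left hle hi.le
          _ = r i := mul_div_cancel₀ _ hi.ne
      · -- a zero row
        rw [hi, zero_mul]
        exact hpos i hi.ge
      · -- a positive row: `y ≤ rᵢ / aᵢ` by the pair condition with the maximising negative row
        rcases le_total (r i₀ / a i₀) 0 with h0 | h0
        · rw [max_eq_left h0, mul_zero]
          exact hpos i hi.le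
        · rw [max_eq_right h0, ← mul_div_assoc, div_le_iff_of_neg ha₀]
          nlinarith [hpair i₀ i ha₀ hi]
    · refine ⟨0, le_rfl, fun i => ?_⟩
      rw [mul_zero]
      exact hpos i (not_lt.1 fun hi => hS ⟨i, mem_filter.2 ⟨mem_univ _, hi⟩⟩)

/-! ### The psd variable in dimensions `0` and `1` -/

/-- In dimension `q = 0` the semidefinite system `∃ Y ⪰ 0, ∀ i, tr (Aᵢ Y) ≤ Rᵢ` is feasible iff
all right-hand sides are non-negative: the empty matrix is psd and every trace over `Fin 0`
vanishes. [folklore] -/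
theorem sdp_dim_zero_iff {p : ℕ} (A : Fin p → Matrix (Fin 0) (Fin 0) ℝ) (R : Fin p → ℝ) :
    (∃ Y : Matrix (Fin 0) (Fin 0) ℝ, Y.PosSemidef ∧ ∀ i, (A i * Y).trace ≤ R i) ↔
      ∀ i, 0 ≤ R i := by
  constructor
  · rintro ⟨Y, -, hY⟩ i
    simpa only [trace_fin_zero] using hY i
  · intro h
    exact ⟨0, PosSemidef.zero, fun i => by simpa only [trace_fin_zero] using h i⟩

/-- A real `1 × 1` matrix is psd iff its entry is non-negative. [folklore] -/
theorem posSemidef_fin_one_iff (Y : Matrix (Fin 1) (Fin 1) ℝ) : Y.PosSemidef ↔ 0 ≤ Y 0 0 := by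
  have hY : diagonal (fun _ : Fin 1 => Y 0 0) = Y := by
    ext i j
    rw [Subsingleton.elim i 0, Subsingleton.elim j 0, diagonal_apply_eq]
  calc Y.PosSemidef ↔ (diagonal fun _ : Fin 1 => Y 0 0).PosSemidef := by rw [hY]
    _ ↔ 0 ≤ Y 0 0 := by
      rw [posSemidef_diagonal_iff]
      exact ⟨fun h => h 0, fun h _ => h⟩

/-- In dimension `q = 1` the semidefinite system `∃ Y ⪰ 0, ∀ i, tr (Aᵢ Y) ≤ Rᵢ` is the scalar
system `∃ y ≥ 0, ∀ i, aᵢ y ≤ Rᵢ` with `aᵢ = Aᵢ 0 0`. [folklore] -/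
theorem sdp_dim_one_iff {p : ℕ} (A : Fin p → Matrix (Fin 1) (Fin 1) ℝ) (R : Fin p → ℝ) :
    (∃ Y : Matrix (Fin 1) (Fin 1) ℝ, Y.PosSemidef ∧ ∀ i, (A i * Y).trace ≤ R i) ↔
      ∃ y : ℝ, 0 ≤ y ∧ ∀ i, A i 0 0 * y ≤ R i := by
  have htr : ∀ (i) (Y : Matrix (Fin 1) (Fin 1) ℝ), (A i * Y).trace = A i 0 0 * Y 0 0 :=
    fun i Y => by rw [trace_fin_one, mul_apply, Fin.sum_univ_one]
  constructor
  · rintro ⟨Y, hY, hc⟩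
    refine ⟨Y 0 0, (posSemidef_fin_one_iff Y).1 hY, fun i => ?_⟩
    rw [← htr]
    exact hc i
  · rintro ⟨y, hy, hc⟩
    refine ⟨diagonal fun _ => y, posSemidef_diagonal_iff.2 fun _ => hy, fun i => ?_⟩
    rw [htr, diagonal_apply_eq]
    exact hc i

/-! ### Realising the eliminated system by non-negatively weighted thresholds -/

/-- A threshold condition guarded by a decidable side condition `c` is an unguarded threshold
condition: switch the data off (to the vacuous `0 ≤ ∑ⱼ 0 · xⱼ`) when `c` fails. [folklore] -/
theorem guarded_threshold_iff {n : ℕ} (c : Prop) [Decidable c] (h₀ : ℝ) (β₀ x : Fin n → ℝ) :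
    (c → h₀ ≤ ∑ j, β₀ j * x j) ↔
      (if c then h₀ else 0) ≤ ∑ j, (if c then β₀ j else 0) * x j := by
  by_cases hc : c
  · have h1 : ∀ j, (if c then β₀ j else 0) * x j = β₀ j * x j := fun j => by rw [if_pos hc]
    rw [if_pos hc, sum_congr rfl fun j _ => h1 j]
    exact ⟨fun h => h hc, fun h _ => h⟩
  · have h1 : ∀ j, (if c then β₀ j else 0) * x j = 0 := fun j => by rw [if_neg hc, zero_mul]
    rw [if_neg hc, sum_eq_zero fun j _ => h1 j]
    exact iff_of_true (fun h => absurd h hc) le_rfl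

/-- The Fourier–Motzkin conditions of the system `aᵢ y ≤ bᵢ + ∑ⱼ Bᵢⱼ xⱼ, y ≥ 0` (`B ≥ 0`) are
an AND of `p + p²` threshold conditions `h_l ≤ ∑ⱼ β_{lj} xⱼ` with `β ≥ 0`: the rows `i` with
`aᵢ ≥ 0` give `-bᵢ ≤ ∑ⱼ Bᵢⱼ xⱼ`, the pairs `aᵢ < 0 < aᵢ'` give
`-(aᵢ' bᵢ + (-aᵢ) bᵢ') ≤ ∑ⱼ (aᵢ' Bᵢⱼ + (-aᵢ) Bᵢ'ⱼ) xⱼ`, all other indices the vacuous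
condition. [folklore] -/
theorem fmConditions_thresholds {p n : ℕ} (a b : Fin p → ℝ) (B : Fin p → Fin n → ℝ)
    (hB : ∀ i j, 0 ≤ B i j) :
    ∃ (β : Fin (p + p * p) → Fin n → ℝ) (h : Fin (p + p * p) → ℝ), (∀ l j, 0 ≤ β l j) ∧
      ∀ x : Fin n → ℝ,
        ((∀ i, 0 ≤ a i → 0 ≤ b i + ∑ j, B i j * x j) ∧
          ∀ i i', a i < 0 → 0 < a i' →
            0 ≤ a i' * (b i + ∑ j, B i j * x j) + (-a i) * (b i' + ∑ j, B i' j * x j)) ↔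
        ∀ l, h l ≤ ∑ j, β l j * x j := by
  -- the structured index set `Fin p ⊕ Fin p × Fin p` (rows, then pairs) and its enumeration
  let e : Fin p ⊕ Fin p × Fin p ≃ Fin (p + p * p) :=
    (Equiv.sumCongr (Equiv.refl (Fin p)) finProdFinEquiv).trans finSumFinEquiv
  let β' : Fin p ⊕ Fin p × Fin p → Fin n → ℝ := Sum.elim (fun i j => if 0 ≤ a i then B i j else 0)
    fun ii j => if a ii.1 < 0 ∧ 0 < a ii.2 then a ii.2 * B ii.1 j + (-a ii.1) * B ii.2 j else 0
  let h' : Fin p ⊕ Fin p × Fin p → ℝ := Sum.elim (fun i => if 0 ≤ a i then -b i else 0)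
    fun ii => if a ii.1 < 0 ∧ 0 < a ii.2 then -(a ii.2 * b ii.1 + (-a ii.1) * b ii.2) else 0
  have hβ' : ∀ z j, 0 ≤ β' z j := by
    rintro (i | ⟨i, i'⟩) j
    · show 0 ≤ (if 0 ≤ a i then B i j else 0)
      split_ifs
      exacts [hB i j, le_rfl]
    · show 0 ≤ (if a i < 0 ∧ 0 < a i' then a i' * B i j + (-a i) * B i' j else 0)
      split_ifs with hc
      · exact add_nonneg (mul_nonneg hc.2.le (hB _ _)) (mul_nonneg (neg_nonneg.2 hc.1.le) (hB _ _))
      · exact le_rfl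
  have hiff : ∀ x : Fin n → ℝ,
      ((∀ i, 0 ≤ a i → 0 ≤ b i + ∑ j, B i j * x j) ∧
          ∀ i i', a i < 0 → 0 < a i' →
            0 ≤ a i' * (b i + ∑ j, B i j * x j) + (-a i) * (b i' + ∑ j, B i' j * x j)) ↔
        ∀ z, h' z ≤ ∑ j, β' z j * x j := by
    intro x
    rw [Sum.forall, Prod.forall]
    refine and_congr (forall_congr' fun i => ?_) (forall_congr' fun i => forall_congr' fun i' => ?_)
    · show _ ↔ (if 0 ≤ a i then -b i else 0) ≤ ∑ j, (if 0 ≤ a i then B i j else 0) * x j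
      rw [← guarded_threshold_iff]
      refine imp_congr_right fun _ => ?_
      constructor <;> intro h <;> linarith
    · show _ ↔ (if a i < 0 ∧ 0 < a i' then -(a i' * b i + (-a i) * b i') else 0) ≤
          ∑ j, (if a i < 0 ∧ 0 < a i' then a i' * B i j + (-a i) * B i' j else 0) * x j
      rw [← guarded_threshold_iff, and_imp]
      refine imp_congr_right fun _ => imp_congr_right fun _ => ?_
      have hsum : ∑ j, (a i' * B i j + (-a i) * B i' j) * x j =
          a i' * ∑ j, B i j * x j + (-a i) * ∑ j, B i' j * x j := by
        simp only [add_mul, mul_assoc, sum_add_distrib, mul_sum]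
      rw [hsum]
      constructor <;> intro h <;> linarith
  exact ⟨fun l => β' (e.symm l), fun l => h' (e.symm l), fun l j => hβ' _ _, fun x =>
    (hiff x).trans (e.forall_congr_left (p := fun z => h' z ≤ ∑ j, β' z j * x j))⟩

/-! ### The stub -/

/-- STUB `stub_convLowDimStructure` of line `width-threshold-certificate-sparsity`: a CONV gate of
width `≤ s` whose psd variable has dimension `q ≤ 1` computes an AND of at most `(s+1)²`
non-negatively weighted REAL threshold functions of its inputs (`q = 0`: `Y` is the empty
matrix, `tr (Aᵢ Y) = 0`, the rows `0 ≤ bᵢ + ∑ⱼ Bᵢⱼ [vⱼ]` themselves; `q = 1`: `Y = (y)`,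
`y ≥ 0`, `tr (Aᵢ Y) = aᵢ y`, and Fourier–Motzkin elimination of `y`: rows with `aᵢ ≥ 0` give
`0 ≤ rᵢ(v)`, pairs `aᵢ < 0 < aᵢ'` give `0 ≤ aᵢ' rᵢ(v) + |aᵢ| rᵢ'(v)`, all with non-negative
coefficients in `v`). [folklore] -/
theorem stub_convLowDimStructure : ∀ (s : ℕ) (φ : GateFn),
    (∃ p q : ℕ, p + q ≤ s ∧ q ≤ 1 ∧ ∃ (A : Fin p → Matrix (Fin q) (Fin q) ℝ) (b : Fin p → ℝ)
      (B : Fin p → Fin φ.1 → ℝ), (∀ i j, 0 ≤ B i j) ∧ ∀ v : Fin φ.1 → Bool, φ.2 v = true ↔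
        ∃ Y : Matrix (Fin q) (Fin q) ℝ, Y.PosSemidef ∧
          ∀ i, (A i * Y).trace ≤ b i + ∑ j, B i j * (if v j then (1 : ℝ) else 0)) →
    ∃ (K : ℕ) (β : Fin K → Fin φ.1 → ℝ) (h : Fin K → ℝ), K ≤ (s + 1) ^ 2 ∧ (∀ l j, 0 ≤ β l j) ∧
      ∀ v : Fin φ.1 → Bool, φ.2 v = true ↔ ∀ l, h l ≤ ∑ j, β l j * (if v j then (1 : ℝ) else 0) := by
  rintro s φ ⟨p, q, hpq, hq, A, b, B, hB, hφ⟩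
  rcases Nat.le_one_iff_eq_zero_or_eq_one.1 hq with rfl | rfl
  · -- `q = 0`: the rows themselves
    refine ⟨p, B, fun i => -b i, ?_, hB, fun v => ?_⟩
    · calc p = p * 1 := (mul_one p).symm
        _ ≤ (s + 1) * (s + 1) := Nat.mul_le_mul (by omega) (by omega)
        _ = (s + 1) ^ 2 := (sq _).symm
    · rw [hφ v, sdp_dim_zero_iff]
      refine forall_congr' fun i => ?_
      constructor <;> intro h <;> linarith
  · -- `q = 1`: Fourier–Motzkin on the single scalar variable
    obtain ⟨β, h, hβ, hiff⟩ := fmConditions_thresholds (fun i => A i 0 0) b B hB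
    refine ⟨p + p * p, β, h, ?_, hβ, fun v => ?_⟩
    · calc p + p * p = p * (p + 1) := by ring
        _ ≤ (s + 1) * (s + 1) := Nat.mul_le_mul (by omega) (by omega)
        _ = (s + 1) ^ 2 := (sq _).symm
    · rw [hφ v, sdp_dim_one_iff A, fourierMotzkin_one (fun i => A i 0 0)]
      exact hiff _

end Summit.PneNP.PneNP.Theorems.CliqueExtLowerBound.WidthThreshold.ConvLowDim
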